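import Summits.Ventures.Crystal3D.Theorems.StickyWulffConstantTextureLiminfTexShadowFLayerDefs
import HarnessLib

/-!
# T-F2 SPLIT (cf-p1 DECISION (civ)): F_layer = ONE-FCC ∪ BOTH-FAULTED, and `stub_famFaulted` from the split

HONEST FRAMING. Venture `Summits/Ventures/Crystal3D` (cell `crystal3d-full`); DEFINITIONS + pure-logic glue for lane T's debt
T-F2 = `stub_famFaulted` (TexShadow v8.x, crux `TextureLiminfV5` stmt-Ventures-23912; owner 19481-p1).  Census-free, standard axioms;
NOTHING about the stubs is proved here; F-C1 not moved.  cf-p1 DECISION (civ) (2026-08-29T04:31:28Z) on the sink-side findings memo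
HOME/wall-19481-p1/g15/F-LAYER-SINKS-g15.md (evidence #56 on stmt-Ventures-19481): the F_layer law of record `FLayerTwinFamilyAt`
(…TexShadowFLayerDefs) is SPLIT by the two plates' Hägg words —

* **`FLayerTwinFamilyOneFccAt c₀ C R₀`** — exactly ONE plate sign-constant (fcc), the other any Hägg word: PROVABLE NOW by the faulted
  plate's falling opposite-tree word net (sources = h ∪ c_opp layers; exclusion `word_noTop_of_inner_zero`-type; single-system v2(A) rows;
  twin two-plate row cell with mirrored pull-back; margin ×2 — memo §2/§4(a));
* **`FLayerTwinFamilyBothFaultedAt c₀ C R₀`** — BOTH words non-constant: the per-walker counts are structurally blind here (memo §2(b));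
  line of record = global line-compensation certificate (b1), sizing memo first;
* `FLayerTwinFamilyNotBothFccAt c₀ C R₀` — the `¬ BothFcc` part of `FLayerTwinFamilyAt`, which is all that `stub_famFaulted` consumes;
  `fLayerNotBothFcc_of_split` — OneFcc + BothFaulted ⇒ NotBothFcc (max of constants);
* `faultedOnReachCoaxialAt_of_notBothFcc_offFamily`, `faultedZigCoaxialAt_of_notBothFcc_offFamily` — p687975's bridges with the
  `¬ BothFcc` part in place of the full law (same one-line proofs);
* **`famFaulted_of_split`** — `(∃ C, OneFccAt) → (∃ C, BothFaultedAt) → (∃ C, …OnReachOffFamilyAt) → (∃ C, …ZigOffFamilyAt) →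
  stub_famFaulted's statement `(∃ C, BilayerWallFaultedOnReachCoaxialAt c₀ C R₀) ∧ (∃ C, BilayerWallFaultedZigCoaxialAt c₀ C R₀)`
  (the two off-family remainders of p687975 stay hypotheses, as there).
WHAT THIS IS NOT: no proof of either half; F-C1 not moved.
-/

noncomputable section

open scoped BigOperators InnerProductSpace ENNReal
open MeasureTheory

namespace Summit.Ventures.Crystal3D.Cruxes.TextureLiminf.TexShadow

open Summit.Ventures.Crystal3D Summit.Ventures.Crystal3D.Theorems
open Literature.MathematicalPhysics.StatisticalMechanics (IsHaggSeq basalMirror)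

/-- **F_layer, ONE-FCC half**: exactly one of the two presented Hägg words is sign-constant. -/
def FLayerTwinFamilyOneFccAt (c₀ C R₀ : ℝ) : Prop :=
  ∀ (σ₁ σ₂ : ℤ → ℤ), IsHaggSeq σ₁ → IsHaggSeq σ₂ →
    ((∀ k : ℤ, σ₁ k = σ₁ 0) ∨ (∀ k : ℤ, σ₂ k = σ₂ 0)) → ¬ BothFcc σ₁ σ₂ →
    ∀ (L₁ L₂ P : E3 ≃ₗᵢ[ℝ] E3) (s₁ s₂ : E3) (A₁ A₂ : ℤ → (E3 ≃ₗᵢ[ℝ] E3)) (u₁ u₂ : ℤ → E3),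
    BilayerFramesAt L₁ s₁ σ₁ A₁ u₁ → BilayerFramesAt L₂ s₂ σ₂ A₂ u₂ → InTwinFamily P A₁ → InTwinFamily P A₂ →
    ∀ (c : ℤ → ℤ → ℝ) (m : ℤ → ℤ → E3), BilayerChargeAdmissibleAt c₀ A₁ A₂ c m →
      BilayerWallAt C R₀ σ₁ σ₂ L₁ L₂ s₁ s₂ c

/-- **F_layer, BOTH-FAULTED half**: neither presented Hägg word is sign-constant. -/
def FLayerTwinFamilyBothFaultedAt (c₀ C R₀ : ℝ) : Prop :=
  ∀ (σ₁ σ₂ : ℤ → ℤ), IsHaggSeq σ₁ → IsHaggSeq σ₂ →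
    ¬ (∀ k : ℤ, σ₁ k = σ₁ 0) → ¬ (∀ k : ℤ, σ₂ k = σ₂ 0) →
    ∀ (L₁ L₂ P : E3 ≃ₗᵢ[ℝ] E3) (s₁ s₂ : E3) (A₁ A₂ : ℤ → (E3 ≃ₗᵢ[ℝ] E3)) (u₁ u₂ : ℤ → E3),
    BilayerFramesAt L₁ s₁ σ₁ A₁ u₁ → BilayerFramesAt L₂ s₂ σ₂ A₂ u₂ → InTwinFamily P A₁ → InTwinFamily P A₂ →
    ∀ (c : ℤ → ℤ → ℝ) (m : ℤ → ℤ → E3), BilayerChargeAdmissibleAt c₀ A₁ A₂ c m →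
      BilayerWallAt C R₀ σ₁ σ₂ L₁ L₂ s₁ s₂ c

/-- **F_layer off `BothFcc`**: the part of `FLayerTwinFamilyAt` with `¬ BothFcc σ₁ σ₂` (all that `stub_famFaulted` consumes). -/
def FLayerTwinFamilyNotBothFccAt (c₀ C R₀ : ℝ) : Prop :=
  ∀ (σ₁ σ₂ : ℤ → ℤ), IsHaggSeq σ₁ → IsHaggSeq σ₂ → ¬ BothFcc σ₁ σ₂ →
    ∀ (L₁ L₂ P : E3 ≃ₗᵢ[ℝ] E3) (s₁ s₂ : E3) (A₁ A₂ : ℤ → (E3 ≃ₗᵢ[ℝ] E3)) (u₁ u₂ : ℤ → E3),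
    BilayerFramesAt L₁ s₁ σ₁ A₁ u₁ → BilayerFramesAt L₂ s₂ σ₂ A₂ u₂ → InTwinFamily P A₁ → InTwinFamily P A₂ →
    ∀ (c : ℤ → ℤ → ℝ) (m : ℤ → ℤ → E3), BilayerChargeAdmissibleAt c₀ A₁ A₂ c m →
      BilayerWallAt C R₀ σ₁ σ₂ L₁ L₂ s₁ s₂ c

/-- The full law restricts to its `¬ BothFcc` part. -/
theorem fLayerNotBothFcc_of_fLayer {c₀ C R₀ : ℝ} (h : FLayerTwinFamilyAt c₀ C R₀) : FLayerTwinFamilyNotBothFccAt c₀ C R₀ :=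
  fun σ₁ σ₂ hσ₁ hσ₂ _ L₁ L₂ P s₁ s₂ A₁ A₂ u₁ u₂ hfr₁ hfr₂ h₁ h₂ c m hadm =>
    h σ₁ σ₂ hσ₁ hσ₂ L₁ L₂ P s₁ s₂ A₁ A₂ u₁ u₂ hfr₁ hfr₂ h₁ h₂ c m hadm

/-- **The split**: ONE-FCC at `C₁` and BOTH-FAULTED at `C₂` give the `¬ BothFcc` part at `max C₁ C₂` (`R₀ ≥ 0`). -/
theorem fLayerNotBothFcc_of_split {c₀ C₁ C₂ R₀ : ℝ} (hR₀ : 0 ≤ R₀) (h₁ : FLayerTwinFamilyOneFccAt c₀ C₁ R₀)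
    (h₂ : FLayerTwinFamilyBothFaultedAt c₀ C₂ R₀) : FLayerTwinFamilyNotBothFccAt c₀ (max C₁ C₂) R₀ := by
  intro σ₁ σ₂ hσ₁ hσ₂ hnb L₁ L₂ P s₁ s₂ A₁ A₂ u₁ u₂ hfr₁ hfr₂ hf₁ hf₂ c m hadm
  by_cases hone : (∀ k : ℤ, σ₁ k = σ₁ 0) ∨ (∀ k : ℤ, σ₂ k = σ₂ 0)
  · exact bilayerWallAt_mono hR₀ (le_max_left _ _)
      (h₁ σ₁ σ₂ hσ₁ hσ₂ hone hnb L₁ L₂ P s₁ s₂ A₁ A₂ u₁ u₂ hfr₁ hfr₂ hf₁ hf₂ c m hadm)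
  · rw [not_or] at hone
    exact bilayerWallAt_mono hR₀ (le_max_right _ _)
      (h₂ σ₁ σ₂ hσ₁ hσ₂ hone.1 hone.2 L₁ L₂ P s₁ s₂ A₁ A₂ u₁ u₂ hfr₁ hfr₂ hf₁ hf₂ c m hadm)

/-- p687975's corner-keyed bridge with the `¬ BothFcc` part in place of the full law. -/
theorem faultedOnReachCoaxialAt_of_notBothFcc_offFamily {c₀ C R₀ : ℝ} (hF : FLayerTwinFamilyNotBothFccAt c₀ C R₀)
    (hO : BilayerWallFaultedOnReachOffFamilyAt c₀ C R₀) : BilayerWallFaultedOnReachCoaxialAt c₀ C R₀ := by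
  intro σ₁ σ₂ hσ₁ hσ₂ hnb L₁ L₂ s₁ s₂ A₁ A₂ u₁ u₂ hfr₁ hfr₂ hgen c m hadm hdom hco
  by_cases hfam : ∃ P : E3 ≃ₗᵢ[ℝ] E3, InTwinFamily P A₁ ∧ InTwinFamily P A₂
  · obtain ⟨P, h₁, h₂⟩ := hfam
    exact hF σ₁ σ₂ hσ₁ hσ₂ hnb L₁ L₂ P s₁ s₂ A₁ A₂ u₁ u₂ hfr₁ hfr₂ h₁ h₂ c m hadm
  · exact hO σ₁ σ₂ hσ₁ hσ₂ hnb L₁ L₂ s₁ s₂ A₁ A₂ u₁ u₂ hfr₁ hfr₂ hfam hgen c m hadm hdom hco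

/-- p687975's zig-keyed bridge with the `¬ BothFcc` part in place of the full law. -/
theorem faultedZigCoaxialAt_of_notBothFcc_offFamily {c₀ C R₀ : ℝ} (hF : FLayerTwinFamilyNotBothFccAt c₀ C R₀)
    (hO : BilayerWallFaultedZigOffFamilyAt c₀ C R₀) : BilayerWallFaultedZigCoaxialAt c₀ C R₀ := by
  intro σ₁ σ₂ hσ₁ hσ₂ hnb L₁ L₂ s₁ s₂ A₁ A₂ u₁ u₂ hfr₁ hfr₂ hgen c m hadm hΔ₁ hΔ₂ hflux hoff hrow hzig hco
  by_cases hfam : ∃ P : E3 ≃ₗᵢ[ℝ] E3, InTwinFamily P A₁ ∧ InTwinFamily P A₂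
  · obtain ⟨P, h₁, h₂⟩ := hfam
    exact hF σ₁ σ₂ hσ₁ hσ₂ hnb L₁ L₂ P s₁ s₂ A₁ A₂ u₁ u₂ hfr₁ hfr₂ h₁ h₂ c m hadm
  · exact hO σ₁ σ₂ hσ₁ hσ₂ hnb L₁ L₂ s₁ s₂ A₁ A₂ u₁ u₂ hfr₁ hfr₂ hfam hgen c m hadm hΔ₁ hΔ₂ hflux hoff hrow hzig hco

/-- **`stub_famFaulted` from the split** (and p687975's two off-family remainders): all at cap `c₀`, radius `R₀ ≥ 0`,
existential rim constants. -/
theorem famFaulted_of_split {c₀ R₀ : ℝ} (hR₀ : 0 ≤ R₀) (h₁ : ∃ C, FLayerTwinFamilyOneFccAt c₀ C R₀)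
    (h₂ : ∃ C, FLayerTwinFamilyBothFaultedAt c₀ C R₀) (hO₁ : ∃ C, BilayerWallFaultedOnReachOffFamilyAt c₀ C R₀)
    (hO₂ : ∃ C, BilayerWallFaultedZigOffFamilyAt c₀ C R₀) :
    (∃ C, BilayerWallFaultedOnReachCoaxialAt c₀ C R₀) ∧ (∃ C, BilayerWallFaultedZigCoaxialAt c₀ C R₀) := by
  obtain ⟨C₁, hC₁⟩ := h₁
  obtain ⟨C₂, hC₂⟩ := h₂
  obtain ⟨D₁, hD₁⟩ := hO₁
  obtain ⟨D₂, hD₂⟩ := hO₂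
  have hF := fLayerNotBothFcc_of_split hR₀ hC₁ hC₂
  refine ⟨⟨max (max C₁ C₂) D₁, faultedOnReachCoaxialAt_of_notBothFcc_offFamily ?_ ?_⟩,
    ⟨max (max C₁ C₂) D₂, faultedZigCoaxialAt_of_notBothFcc_offFamily ?_ ?_⟩⟩
  · exact fun σ₁ σ₂ hσ₁ hσ₂ hnb L₁ L₂ P s₁ s₂ A₁ A₂ u₁ u₂ hfr₁ hfr₂ hf₁ hf₂ c m hadm =>
      bilayerWallAt_mono hR₀ (le_max_left _ _) (hF σ₁ σ₂ hσ₁ hσ₂ hnb L₁ L₂ P s₁ s₂ A₁ A₂ u₁ u₂ hfr₁ hfr₂ hf₁ hf₂ c m hadm)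
  · exact fun σ₁ σ₂ hσ₁ hσ₂ hnb L₁ L₂ s₁ s₂ A₁ A₂ u₁ u₂ hfr₁ hfr₂ hfam hgen c m hadm hdom hco =>
      bilayerWallAt_mono hR₀ (le_max_right _ _)
        (hD₁ σ₁ σ₂ hσ₁ hσ₂ hnb L₁ L₂ s₁ s₂ A₁ A₂ u₁ u₂ hfr₁ hfr₂ hfam hgen c m hadm hdom hco)
  · exact fun σ₁ σ₂ hσ₁ hσ₂ hnb L₁ L₂ P s₁ s₂ A₁ A₂ u₁ u₂ hfr₁ hfr₂ hf₁ hf₂ c m hadm =>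
      bilayerWallAt_mono hR₀ (le_max_left _ _) (hF σ₁ σ₂ hσ₁ hσ₂ hnb L₁ L₂ P s₁ s₂ A₁ A₂ u₁ u₂ hfr₁ hfr₂ hf₁ hf₂ c m hadm)
  · exact fun σ₁ σ₂ hσ₁ hσ₂ hnb L₁ L₂ s₁ s₂ A₁ A₂ u₁ u₂ hfr₁ hfr₂ hfam hgen c m hadm hΔ₁ hΔ₂ hflux hoff hrow hzig hco =>
      bilayerWallAt_mono hR₀ (le_max_right _ _)
        (hD₂ σ₁ σ₂ hσ₁ hσ₂ hnb L₁ L₂ s₁ s₂ A₁ A₂ u₁ u₂ hfr₁ hfr₂ hfam hgen c m hadm hΔ₁ hΔ₂ hflux hoff hrow hzig hco)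

/-- The ONE-FCC half is symmetric in the roles «which plate is fcc» only through its hypothesis; for the record, the
constant-word disjunct with `¬ BothFcc` pins the OTHER word as non-constant. -/
theorem oneFcc_cases {σ₁ σ₂ : ℤ → ℤ} (hone : (∀ k : ℤ, σ₁ k = σ₁ 0) ∨ (∀ k : ℤ, σ₂ k = σ₂ 0)) (hnb : ¬ BothFcc σ₁ σ₂) :
    ((∀ k : ℤ, σ₁ k = σ₁ 0) ∧ ¬ (∀ k : ℤ, σ₂ k = σ₂ 0)) ∨ (¬ (∀ k : ℤ, σ₁ k = σ₁ 0) ∧ (∀ k : ℤ, σ₂ k = σ₂ 0)) := by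
  rcases hone with h | h
  · exact Or.inl ⟨h, fun h' => hnb ⟨h, h'⟩⟩
  · exact Or.inr ⟨fun h' => hnb ⟨h', h⟩, h⟩

end Summit.Ventures.Crystal3D.Cruxes.TextureLiminf.TexShadow

end
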